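import Summits.NavierStokesRegularity.NavierStokesRegularity.Theorems.TypeIliouvilleNoTypeII.Negative.NSISuperCascadePieces
import Literature.Barriers.NavierStokesRegularity.SchefferSwitchedIntegrability
import HarnessLib

/-!
# The super-similar switching cascade, II: strip integrals and space–time integrability

Negative-lane support for `Summit.NavierStokesRegularity.NavierStokesRegularity.Theses.TypeILiouville.TypeIliouvilleNoTypeII`
(item `stmt-NavierStokesRegularity-0056`): second part of brick **B2** of the discharge of
`Literature.Barriers.NavierStokesRegularity.NSITypeIIBlowup`, the parametrised copy of the tree's
`SchefferSwitchedStrips` / `SchefferSwitchedIntegrability` for the generalised switched field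
`glueG T σ τ a z u` under `IsSuperBlock T ν₀ τ σ a z G u`.

* the `j`-th strip `[t_j, t_{j+1}) × EuclideanSpace ℝ (Fin 3)` is the preimage of `[0,T) × EuclideanSpace ℝ (Fin 3)` under the piece's affine
  map, with Jacobian `(a⁻¹ τ⁴)ʲ` (`jacobian_eq`);
* on the strip, `𝔲`, `D𝔲`, `p̃[𝔲]‖𝔲‖` are rescaled pull-backs of `u`, `Du`, `p̃[u]‖u‖` with
  amplitudes `aʲ`, `aʲτ^{-j}`, `a^{3j}`;
* the strip integrals of `‖𝔲‖ₑⁿ`, `‖D𝔲‖ₑ`, `|D𝔲|²`, `|p̃[𝔲]|‖𝔲‖` are `(aⁿa⁻¹τ⁴)ʲ`, `(τ³)ʲ`,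
  `(aτ²)ʲ`, `(a²τ⁴)ʲ` times the base integrals over `[0,T) × EuclideanSpace ℝ (Fin 3)`;
* summing the geometric series (ratios `< 1` by `τ⁻¹ < a`, `a²τ³ ≤ 1`, `τ < 1`):
  `∫⁻ ‖𝔲‖ₑⁿ < ∞ (1 ≤ n ≤ 3)`, `∫⁻ ‖D𝔲‖ₑ < ∞`, `∫⁻ |D𝔲|² < ∞`, `∫⁻ |p̃[𝔲]|‖𝔲‖ < ∞`.

[cite: Ozanski2017NSISingular, §2 p. 7] [cite: Scheffer1985, proof of Lemma 2.3 (2.34)];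
the two-parameter bookkeeping is [folklore].
-/

noncomputable section

open MeasureTheory Set Function Filter Topology TopologicalSpace Metric Module
open scoped ENNReal InnerProductSpace RealInnerProductSpace ContDiff Laplacian

set_option linter.dupNamespace false

namespace Summit.NavierStokesRegularity.NavierStokesRegularity.Theorems.TypeIliouvilleNoTypeIINegative

open Literature.Analysis.FluidPDE Literature.Barriers.NavierStokesRegularity
open Literature.Barriers.NavierStokesRegularity.Scheffer

namespace IsSuperBlock

variable {T ν₀ τ σ a : ℝ} {z : EuclideanSpace ℝ (Fin 3)} {G : Set (EuclideanSpace ℝ (Fin 3))} {u : ℝ → EuclideanSpace ℝ (Fin 3) → EuclideanSpace ℝ (Fin 3)}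

/-! ### The strips as preimages and the Jacobian factor -/

/-- **The `j`-th strip is the preimage of `[0, T) × EuclideanSpace ℝ (Fin 3)`** under the affine map of the `j`-th
piece. [cite: Ozanski2017NSISingular, §2 (2.4)] -/
theorem preimage_stAffine_eq_strip (h : IsSuperBlock T ν₀ τ σ a z G u) (j : ℕ) :
    stAffine ((σ⁻¹) ^ (2 * j)) ((τ⁻¹) ^ j) (-((σ⁻¹) ^ (2 * j) * switchTime T σ j))
        ((1 - (τ⁻¹) ^ j) • (1 - τ)⁻¹ • z) ⁻¹' (Ico 0 T ×ˢ (univ : Set (EuclideanSpace ℝ (Fin 3)))) =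
      Ico (switchTime T σ j) (switchTime T σ (j + 1)) ×ˢ univ := by
  have hβ : 0 < (σ⁻¹) ^ (2 * j) := h.inv_σ_pow_pos _
  have hinv : (σ⁻¹) ^ (2 * j) * σ ^ (2 * j) = 1 := by
    rw [inv_pow, inv_mul_cancel₀ (pow_ne_zero _ h.σ_pos.ne')]
  ext ⟨s, x⟩
  simp only [mem_preimage, stAffine_apply, mem_prod, mem_Ico, mem_univ, and_true, switchTime_succ]
  have e : -((σ⁻¹) ^ (2 * j) * switchTime T σ j) + (σ⁻¹) ^ (2 * j) * s =
      (σ⁻¹) ^ (2 * j) * (s - switchTime T σ j) := by ring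
  rw [e]
  constructor
  · rintro ⟨h1, h2⟩
    refine ⟨by nlinarith [mul_nonneg_iff_of_pos_left hβ |>.1 h1], ?_⟩
    have h3 : (σ⁻¹) ^ (2 * j) * (s - switchTime T σ j) * σ ^ (2 * j) < T * σ ^ (2 * j) :=
      mul_lt_mul_of_pos_right h2 (pow_pos h.σ_pos _)
    have h4 : (σ⁻¹) ^ (2 * j) * (s - switchTime T σ j) * σ ^ (2 * j) = s - switchTime T σ j := by
      rw [mul_comm ((σ⁻¹) ^ (2 * j)), mul_assoc, hinv, mul_one]
    linarith
  · rintro ⟨h1, h2⟩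
    refine ⟨mul_nonneg hβ.le (by linarith), ?_⟩
    calc (σ⁻¹) ^ (2 * j) * (s - switchTime T σ j)
        < (σ⁻¹) ^ (2 * j) * (T * σ ^ (2 * j)) := mul_lt_mul_of_pos_left (by linarith) hβ
      _ = T := by rw [mul_comm T, ← mul_assoc, hinv, one_mul]

/-- **The Jacobian factor of the `j`-th affine map is `(a⁻¹τ⁴)ʲ`**:
`(σ^{-2j} (τ^{-j})³)⁻¹ = (aʲτ^{-4j})⁻¹`. [folklore] -/
theorem jacobian_eq (h : IsSuperBlock T ν₀ τ σ a z G u) (j : ℕ) :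
    ((σ⁻¹) ^ (2 * j) * ((τ⁻¹) ^ j) ^ finrank ℝ (EuclideanSpace ℝ (Fin 3)))⁻¹ = (a⁻¹ * τ ^ 4) ^ j := by
  rw [finrank_euclideanSpace_fin, h.inv_σ_pow_two_mul]
  have e : a ^ j * (τ⁻¹) ^ j * ((τ⁻¹) ^ j) ^ 3 = (a * (τ⁻¹) ^ 4) ^ j := by ring
  rw [e, ← inv_pow, mul_inv, inv_pow, inv_inv]

/-! ### The glued field on the strips as rescaled pull-backs -/

/-- On the `j`-th strip the glued field is the rescaled pull-back `aʲ u ∘ Φⱼ`. [cite: Ozanski2017NSISingular, §2 (2.4)] -/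
theorem glueG_eq_smul_stPull (h : IsSuperBlock T ν₀ τ σ a z G u) {j : ℕ} {s : ℝ}
    (hs : s ∈ Ico (switchTime T σ j) (switchTime T σ (j + 1))) (x : EuclideanSpace ℝ (Fin 3)) :
    glueG T σ τ a z u s x = (a ^ j • stPull ((σ⁻¹) ^ (2 * j)) ((τ⁻¹) ^ j)
      (-((σ⁻¹) ^ (2 * j) * switchTime T σ j)) ((1 - (τ⁻¹) ^ j) • (1 - τ)⁻¹ • z) u) s x := by
  rw [glueG_eq_pieceG h.T_pos h.σ_pos τ a z u hs]
  rfl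

/-- On the `j`-th strip the slice derivative of the glued field is `aʲτ^{-j} Du ∘ Φⱼ`. [folklore] -/
theorem fderiv_glueG_eq_smul_stPull (h : IsSuperBlock T ν₀ τ σ a z G u) {j : ℕ} {s : ℝ}
    (hs : s ∈ Ico (switchTime T σ j) (switchTime T σ (j + 1))) (x : EuclideanSpace ℝ (Fin 3)) :
    fderiv ℝ (glueG T σ τ a z u s) x = ((a ^ j * (τ⁻¹) ^ j) • stPull ((σ⁻¹) ^ (2 * j)) ((τ⁻¹) ^ j)
      (-((σ⁻¹) ^ (2 * j) * switchTime T σ j)) ((1 - (τ⁻¹) ^ j) • (1 - τ)⁻¹ • z)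
        (fun r y => fderiv ℝ (u r) y)) s x := by
  rw [glueG_eq_pieceG h.T_pos h.σ_pos τ a z u hs]
  have hs' := h.localTime_mem (Ico_subset_Icc_self hs)
  have hu1 : ContDiff ℝ 1 (u (-((σ⁻¹) ^ (2 * j) * switchTime T σ j) + (σ⁻¹) ^ (2 * j) * s)) :=
    (h.block.contDiff_slice hs').of_le (by norm_cast)
  have hd : DifferentiableAt ℝ (stPull ((σ⁻¹) ^ (2 * j)) ((τ⁻¹) ^ j)
      (-((σ⁻¹) ^ (2 * j) * switchTime T σ j)) ((1 - (τ⁻¹) ^ j) • (1 - τ)⁻¹ • z) u s) x :=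
    differentiable_stPull_slice (hu1.differentiable (by simp)) x
  rw [pieceG, show (a ^ j • stPull ((σ⁻¹) ^ (2 * j)) ((τ⁻¹) ^ j)
      (-((σ⁻¹) ^ (2 * j) * switchTime T σ j)) ((1 - (τ⁻¹) ^ j) • (1 - τ)⁻¹ • z) u) s =
      a ^ j • stPull ((σ⁻¹) ^ (2 * j)) ((τ⁻¹) ^ j)
        (-((σ⁻¹) ^ (2 * j) * switchTime T σ j)) ((1 - (τ⁻¹) ^ j) • (1 - τ)⁻¹ • z) u s from rfl,
    fderiv_const_smul hd, fderiv_stPull, smul_smul]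
  rfl

/-- On the `j`-th strip, `p̃[𝔲(s)](x) ‖𝔲(s,x)‖ = a^{3j} (p̃[u] ‖u‖)(Φⱼ(s,x))`. [folklore] -/
theorem pressure_mul_norm_glueG_eq_smul_stPull (h : IsSuperBlock T ν₀ τ σ a z G u) {j : ℕ} {s : ℝ}
    (hs : s ∈ Ico (switchTime T σ j) (switchTime T σ (j + 1))) (x : EuclideanSpace ℝ (Fin 3)) :
    normalisedPressure (glueG T σ τ a z u s) x * ‖glueG T σ τ a z u s x‖ =
      (((a ^ j) ^ 3) • stPull ((σ⁻¹) ^ (2 * j)) ((τ⁻¹) ^ j)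
        (-((σ⁻¹) ^ (2 * j) * switchTime T σ j)) ((1 - (τ⁻¹) ^ j) • (1 - τ)⁻¹ • z)
        (fun r y => normalisedPressure (u r) y * ‖u r y‖)) s x := by
  rw [glueG_eq_pieceG h.T_pos h.σ_pos τ a z u hs, h.normalisedPressure_pieceG j s x, pieceG_apply]
  simp only [smul_stPull_apply, smul_eq_mul, norm_smul, Real.norm_of_nonneg (h.gain_pow_pos j).le]
  have e : (1 - (τ⁻¹) ^ j) • (1 - τ)⁻¹ • z + (τ⁻¹) ^ j • x =
      (1 - τ)⁻¹ • z + (τ⁻¹) ^ j • (x - (1 - τ)⁻¹ • z) := by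
    rw [sub_smul, one_smul, smul_sub, smul_comm ((τ⁻¹) ^ j) ((1 - τ)⁻¹) z]
    abel
  rw [e]
  ring

/-! ### The strip integrals -/

/-- **Strip integral of powers of the glued field**:
`∫⁻_{[t_j,t_{j+1}) × EuclideanSpace ℝ (Fin 3)} ‖𝔲‖ₑⁿ = (aⁿa⁻¹τ⁴)ʲ ∫⁻_{[0,T) × EuclideanSpace ℝ (Fin 3)} ‖u‖ₑⁿ`. [cite: Scheffer1985, proof of Lemma 2.3 (2.34)] -/
theorem setLIntegral_strip_enorm_glueG_pow (h : IsSuperBlock T ν₀ τ σ a z G u) (j n : ℕ) :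
    ∫⁻ q in Ico (switchTime T σ j) (switchTime T σ (j + 1)) ×ˢ (univ : Set (EuclideanSpace ℝ (Fin 3))),
        ‖glueG T σ τ a z u q.1 q.2‖ₑ ^ n =
      ENNReal.ofReal ((a ^ n * a⁻¹ * τ ^ 4) ^ j) *
        ∫⁻ q in Ico 0 T ×ˢ (univ : Set (EuclideanSpace ℝ (Fin 3))), ‖u q.1 q.2‖ₑ ^ n := by
  rw [setLIntegral_congr_fun (measurableSet_Ico.prod MeasurableSet.univ)
    (fun q hq => by rw [h.glueG_eq_smul_stPull (mem_prod.1 hq).1 q.2]), ← h.preimage_stAffine_eq_strip j,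
    setLIntegral_enorm_pow_stRescale (h.inv_σ_pow_pos _) (h.inv_tau_pow_pos _), h.jacobian_eq,
    Real.enorm_eq_ofReal (h.gain_pow_pos j).le, ← ENNReal.ofReal_pow (h.gain_pow_pos j).le,
    ← ENNReal.ofReal_mul (pow_nonneg (h.gain_pow_pos j).le n), scalar_pow]

/-- **Strip integral of the slice derivative**:
`∫⁻_{[t_j,t_{j+1}) × EuclideanSpace ℝ (Fin 3)} ‖D𝔲‖ₑ = (τ³)ʲ ∫⁻_{[0,T) × EuclideanSpace ℝ (Fin 3)} ‖Du‖ₑ`. [folklore] -/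
theorem setLIntegral_strip_enorm_fderiv_glueG (h : IsSuperBlock T ν₀ τ σ a z G u) (j : ℕ) :
    ∫⁻ q in Ico (switchTime T σ j) (switchTime T σ (j + 1)) ×ˢ (univ : Set (EuclideanSpace ℝ (Fin 3))),
        ‖fderiv ℝ (glueG T σ τ a z u q.1) q.2‖ₑ =
      ENNReal.ofReal ((τ ^ 3) ^ j) *
        ∫⁻ q in Ico 0 T ×ˢ (univ : Set (EuclideanSpace ℝ (Fin 3))), ‖fderiv ℝ (u q.1) q.2‖ₑ := by
  have h1 := setLIntegral_enorm_pow_stRescale (F := EuclideanSpace ℝ (Fin 3) →L[ℝ] EuclideanSpace ℝ (Fin 3))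
    (h.inv_σ_pow_pos (2 * j)) (h.inv_tau_pow_pos j) (-((σ⁻¹) ^ (2 * j) * switchTime T σ j))
    ((1 - (τ⁻¹) ^ j) • (1 - τ)⁻¹ • z) (a ^ j * (τ⁻¹) ^ j) (fun r y => fderiv ℝ (u r) y)
    (Ico 0 T ×ˢ univ) 1
  simp only [pow_one] at h1
  have hc : 0 < a ^ j * (τ⁻¹) ^ j := mul_pos (h.gain_pow_pos j) (h.inv_tau_pow_pos j)
  rw [setLIntegral_congr_fun (measurableSet_Ico.prod MeasurableSet.univ)
    (fun q hq => by rw [h.fderiv_glueG_eq_smul_stPull (mem_prod.1 hq).1 q.2]),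
    ← h.preimage_stAffine_eq_strip j, h1, h.jacobian_eq, Real.enorm_eq_ofReal hc.le,
    ← ENNReal.ofReal_mul hc.le, h.scalar_fderiv j]

/-- **Strip integral of the dissipation**:
`∫⁻_{[t_j,t_{j+1}) × EuclideanSpace ℝ (Fin 3)} |D𝔲|² = (aτ²)ʲ ∫⁻_{[0,T) × EuclideanSpace ℝ (Fin 3)} |Du|²`. [cite: Ozanski2017NSISingular, §2 p. 7] -/
theorem setLIntegral_strip_frobeniusNormSq_glueG (h : IsSuperBlock T ν₀ τ σ a z G u) (j : ℕ) :
    ∫⁻ q in Ico (switchTime T σ j) (switchTime T σ (j + 1)) ×ˢ (univ : Set (EuclideanSpace ℝ (Fin 3))),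
        ENNReal.ofReal (frobeniusNormSq (fderiv ℝ (glueG T σ τ a z u q.1) q.2)) =
      ENNReal.ofReal ((a * τ ^ 2) ^ j) *
        ∫⁻ q in Ico 0 T ×ˢ (univ : Set (EuclideanSpace ℝ (Fin 3))), ENNReal.ofReal (frobeniusNormSq (fderiv ℝ (u q.1) q.2)) := by
  have hc : 0 < a ^ j * (τ⁻¹) ^ j := mul_pos (h.gain_pow_pos j) (h.inv_tau_pow_pos j)
  rw [setLIntegral_congr_fun (measurableSet_Ico.prod MeasurableSet.univ)
    (fun q hq => by rw [h.fderiv_glueG_eq_smul_stPull (mem_prod.1 hq).1 q.2]),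
    ← h.preimage_stAffine_eq_strip j,
    setLIntegral_frobeniusNormSq_stRescale (h.inv_σ_pow_pos _) (h.inv_tau_pow_pos _), h.jacobian_eq,
    ← ENNReal.ofReal_mul (pow_nonneg hc.le 2), h.scalar_frobenius j]

/-- **Strip integral of the pressure term**:
`∫⁻_{[t_j,t_{j+1}) × EuclideanSpace ℝ (Fin 3)} |p̃[𝔲]| ‖𝔲‖ = (a²τ⁴)ʲ ∫⁻_{[0,T) × EuclideanSpace ℝ (Fin 3)} |p̃[u]| ‖u‖`. [cite: Scheffer1985, proof of Lemma 2.3 (2.34)] -/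
theorem setLIntegral_strip_pressure_mul_norm_glueG (h : IsSuperBlock T ν₀ τ σ a z G u) (j : ℕ) :
    ∫⁻ q in Ico (switchTime T σ j) (switchTime T σ (j + 1)) ×ˢ (univ : Set (EuclideanSpace ℝ (Fin 3))),
        ‖normalisedPressure (glueG T σ τ a z u q.1) q.2 * ‖glueG T σ τ a z u q.1 q.2‖‖ₑ =
      ENNReal.ofReal ((a ^ 2 * τ ^ 4) ^ j) *
        ∫⁻ q in Ico 0 T ×ˢ (univ : Set (EuclideanSpace ℝ (Fin 3))), ‖normalisedPressure (u q.1) q.2 * ‖u q.1 q.2‖‖ₑ := by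
  have h1 := setLIntegral_enorm_pow_stRescale (F := ℝ)
    (h.inv_σ_pow_pos (2 * j)) (h.inv_tau_pow_pos j) (-((σ⁻¹) ^ (2 * j) * switchTime T σ j))
    ((1 - (τ⁻¹) ^ j) • (1 - τ)⁻¹ • z) ((a ^ j) ^ 3)
    (fun r y => normalisedPressure (u r) y * ‖u r y‖) (Ico 0 T ×ˢ univ) 1
  simp only [pow_one] at h1
  rw [setLIntegral_congr_fun (measurableSet_Ico.prod MeasurableSet.univ)
    (fun q hq => by rw [h.pressure_mul_norm_glueG_eq_smul_stPull (mem_prod.1 hq).1 q.2]),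
    ← h.preimage_stAffine_eq_strip j, h1, h.jacobian_eq,
    Real.enorm_eq_ofReal (pow_pos (h.gain_pow_pos j) 3).le,
    ← ENNReal.ofReal_mul (pow_pos (h.gain_pow_pos j) 3).le, h.scalar_pressure j]

/-! ### Space–time integrability of the glued field -/

/-- **Space–time integrals of the glued field are sums over the strips.** [cite: Ozanski2017NSISingular, §2 p. 7] -/
theorem lintegral_eq_tsum_strip (h : IsSuperBlock T ν₀ τ σ a z G u) {H : ℝ × EuclideanSpace ℝ (Fin 3) → ℝ≥0∞}
    (hH0 : ∀ q : ℝ × EuclideanSpace ℝ (Fin 3), q.1 ∉ Ico 0 (blowupTime T σ) → H q = 0) :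
    ∫⁻ q, H q = ∑' j : ℕ, ∫⁻ q in Ico (switchTime T σ j) (switchTime T σ (j + 1)) ×ˢ (univ : Set (EuclideanSpace ℝ (Fin 3))), H q := by
  have hU := iUnion_strip_eq (E := EuclideanSpace ℝ (Fin 3)) (strictMono_switchTime h.T_pos h.σ_pos)
    (tendsto_switchTime h.σ_pos.le h.σ_lt_one)
  rw [switchTime_zero] at hU
  rw [← lintegral_iUnion (measurableSet_strip (E := EuclideanSpace ℝ (Fin 3)))
    (pairwise_disjoint_strip (strictMono_switchTime h.T_pos h.σ_pos)), hU]
  refine (setLIntegral_eq_of_support_subset fun q hq => ?_).symm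
  by_contra hq'
  exact hq (hH0 q fun h' => hq' ⟨h', mem_univ _⟩)

/-- Off `[0, T₀)` the glued field vanishes. [folklore] -/
theorem glueG_eq_zero_of_notMem (h : IsSuperBlock T ν₀ τ σ a z G u) {s : ℝ} (hs : s ∉ Ico 0 (blowupTime T σ)) :
    glueG T σ τ a z u s = 0 := by
  by_cases h0 : 0 ≤ s
  · exact glueG_eq_zero_of_le h.T_pos h.σ_pos h.σ_lt_one τ a z u (not_lt.1 fun h' => hs ⟨h0, h'⟩)
  · exact glueG_eq_zero_of_neg h.T_pos h.σ_pos τ a z u (not_le.1 h0)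

/-- **`|𝔲|ⁿ ∈ L¹(ℝ × EuclideanSpace ℝ (Fin 3))` for `1 ≤ n ≤ 3`** (`Σⱼ (aⁿ⁻¹τ⁴)ʲ < ∞`). [cite: Scheffer1985, proof of Lemma 2.3 (2.34)] -/
theorem lintegral_enorm_glueG_pow_lt_top (h : IsSuperBlock T ν₀ τ σ a z G u) {n : ℕ} (hn1 : 1 ≤ n) (hn : n ≤ 3) :
    ∫⁻ q : ℝ × EuclideanSpace ℝ (Fin 3), ‖glueG T σ τ a z u q.1 q.2‖ₑ ^ n < ⊤ := by
  rw [h.lintegral_eq_tsum_strip fun q hq => by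
    simp [h.glueG_eq_zero_of_notMem hq, zero_pow (Nat.one_le_iff_ne_zero.1 hn1)]]
  simp_rw [h.setLIntegral_strip_enorm_glueG_pow]
  rw [ENNReal.tsum_mul_right]
  refine ENNReal.mul_lt_top ?_ (h.block.base_lt_top_norm_pow (Nat.one_le_iff_ne_zero.1 hn1))
  exact IsNSIBlock.tsum_ofReal_pow_lt_top (h.pow_ratio_nonneg n) (h.pow_ratio_lt_one hn)

/-- Off `[0, T₀)` the slice derivative of the glued field vanishes. [folklore] -/
theorem fderiv_glueG_eq_zero_of_notMem (h : IsSuperBlock T ν₀ τ σ a z G u) {s : ℝ}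
    (hs : s ∉ Ico 0 (blowupTime T σ)) (x : EuclideanSpace ℝ (Fin 3)) : fderiv ℝ (glueG T σ τ a z u s) x = 0 := by
  rw [h.glueG_eq_zero_of_notMem hs]
  exact fderiv_const_apply _

/-- **`D𝔲 ∈ L¹(ℝ × EuclideanSpace ℝ (Fin 3))`** (`Σⱼ τ^{3j} < ∞`). [folklore] -/
theorem lintegral_enorm_fderiv_glueG_lt_top (h : IsSuperBlock T ν₀ τ σ a z G u) :
    ∫⁻ q : ℝ × EuclideanSpace ℝ (Fin 3), ‖fderiv ℝ (glueG T σ τ a z u q.1) q.2‖ₑ < ⊤ := by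
  rw [h.lintegral_eq_tsum_strip fun q hq => by
    rw [h.fderiv_glueG_eq_zero_of_notMem hq, ← ofReal_norm, norm_zero, ENNReal.ofReal_zero]]
  simp_rw [h.setLIntegral_strip_enorm_fderiv_glueG]
  rw [ENNReal.tsum_mul_right]
  refine ENNReal.mul_lt_top ?_ h.block.base_lt_top_fderiv
  exact IsNSIBlock.tsum_ofReal_pow_lt_top (pow_nonneg h.τ_pos.le 3) h.pow_three_lt_one

/-- **`|D𝔲|² ∈ L¹(ℝ × EuclideanSpace ℝ (Fin 3))`** (`Σⱼ (aτ²)ʲ < ∞`). [cite: Ozanski2017NSISingular, §2 p. 7] -/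
theorem lintegral_frobeniusNormSq_glueG_lt_top (h : IsSuperBlock T ν₀ τ σ a z G u) :
    ∫⁻ q : ℝ × EuclideanSpace ℝ (Fin 3), ENNReal.ofReal (frobeniusNormSq (fderiv ℝ (glueG T σ τ a z u q.1) q.2)) < ⊤ := by
  rw [h.lintegral_eq_tsum_strip fun q hq => by
    simp [h.fderiv_glueG_eq_zero_of_notMem hq, frobeniusNormSq_zero]]
  simp_rw [h.setLIntegral_strip_frobeniusNormSq_glueG]
  rw [ENNReal.tsum_mul_right]
  exact ENNReal.mul_lt_top (IsNSIBlock.tsum_ofReal_pow_lt_top (mul_nonneg h.gain_pos.le (sq_nonneg τ))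
    h.gain_mul_sq_lt_one) h.block.base_lt_top_frobeniusNormSq

/-- **`|p̃[𝔲]|‖𝔲‖ ∈ L¹(ℝ × EuclideanSpace ℝ (Fin 3))`** (`Σⱼ (a²τ⁴)ʲ < ∞`). [cite: Scheffer1985, proof of Lemma 2.3 (2.34)] -/
theorem lintegral_pressure_mul_norm_glueG_lt_top (h : IsSuperBlock T ν₀ τ σ a z G u) :
    ∫⁻ q : ℝ × EuclideanSpace ℝ (Fin 3), ‖normalisedPressure (glueG T σ τ a z u q.1) q.2 * ‖glueG T σ τ a z u q.1 q.2‖‖ₑ < ⊤ := by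
  rw [h.lintegral_eq_tsum_strip fun q hq => by simp [h.glueG_eq_zero_of_notMem hq]]
  simp_rw [h.setLIntegral_strip_pressure_mul_norm_glueG]
  rw [ENNReal.tsum_mul_right]
  refine ENNReal.mul_lt_top ?_ h.block.base_lt_top_pressure_mul_norm
  exact IsNSIBlock.tsum_ofReal_pow_lt_top (mul_nonneg (sq_nonneg a) (pow_nonneg h.τ_pos.le 4))
    h.gain_sq_mul_pow_four_lt_one

end IsSuperBlock

end Summit.NavierStokesRegularity.NavierStokesRegularity.Theorems.TypeIliouvilleNoTypeIINegative

end
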